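import Summits.ValiantsHypothesis.ValiantsHypothesis.Theorems.SoloBlindPlusLadderDefs

/-!
# The `+`-ladder above the permanent: the valuation ceiling `L(F + M·per) ≤ 1 + M`

`SoloBlindPlusLadderSharp.lean` proves that every monotone fan-in-two circuit computing
`g := F_{n,n} + M · per_n` has size `s` with `min(2^{⌈n/3⌉}, 1 + M) ≤ 8 s (n+1)²`.  Its engine is a
*valuation*: a nonnegative weight `w` on monomials, evaluated linearly on coefficient vectors
(`val w p = ∑_m w(m) · coeff_m p`), which is at most `1` on every admissible term of the structure
decomposition (`ArithCircuit.exists_balanced_decomposition`: ordered products `a · b` on a balanced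
row cut, dominated coefficientwise by `g`) and large on `g`; then the number of terms is at least
`val w g`.

This file proves that NO valuation can do better than `1 + M`:

  if `val w (a · b) ≤ 1` for every balanced ordered product `a · b ≤ F_{n,n} + M · per_n`
  (coefficientwise), then `val w (F_{n,n} + M · per_n) ≤ 1 + M`   (`valuation_ceiling`).

Reason: `F_{n,n} = F_A · F_{Aᶜ}` with `F_A := ∏_{i ∈ A} ∑_j x_{i,j}` is itself ONE balanced ordered
product dominated by `g`, and `g ≤ (1 + M) · F_{n,n}` coefficientwise.  So the reach of coefficient
valuations on this ladder is exactly linear in `M` (between `(1+M)/2` and `1+M` for `M` below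
`2^{⌈n/3⌉}`), and any super-polynomial monotone lower bound at a rung `M = n^{O(1)}` must use an
invariant that is not a nonnegative linear functional of the coefficients.

References: Hrubeš, *On ε-sensitive monotone computations*, Comput. Complexity 29 (2020), Thm 1 and
the remark on coefficient-continuous measures (p. 6); structure theorem as in
Chattopadhyay–Datta–Ghosal–Mukhopadhyay (arXiv:2109.06941) §2.
-/

noncomputable section

open scoped NNReal Nat Classical
open MvPolynomial Finset Literature.Computability.AlgebraicComplexity

namespace Summit.ValiantsHypothesis.ValiantsHypothesis.Theorems

namespace PlusLadder

variable {n : ℕ}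

/-! ### Row products `F_A = ∏_{i ∈ A} ∑_j x_{i,j}` -/

/-- The row product `F_A := ∏_{i ∈ A} ∑_j x_{i,j}` over `ℝ≥0`. -/
def rowProd (A : Finset (Fin n)) : MvPolynomial (Fin n × Fin n) ℝ≥0 :=
  ∏ i ∈ A, ∑ j : Fin n, X (i, j)

/-- A product of variables is the monomial of the sum of their exponents. -/
theorem prod_X_eq_monomial_sum {α : Type*} (s : Finset α) (f : α → Fin n × Fin n) :
    (∏ i ∈ s, X (f i) : MvPolynomial (Fin n × Fin n) ℝ≥0) =
      monomial (∑ i ∈ s, Finsupp.single (f i) 1) 1 := by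
  have hX : ∀ p : Fin n × Fin n,
      (X p : MvPolynomial (Fin n × Fin n) ℝ≥0) = monomial (Finsupp.single p 1) 1 := fun p => rfl
  induction s using Finset.induction_on with
  | empty => rw [prod_empty, sum_empty, ← C_apply, C_1]
  | insert i s hi ih => rw [prod_insert hi, sum_insert hi, ih, hX, monomial_mul, one_mul]

/-- `F_A = ∑_{τ : A → [n]} x_τ`: the row product is the sum of the monomials of all partial maps. -/
theorem rowProd_eq_sum_monomial (A : Finset (Fin n)) :
    rowProd A = ∑ τ : ({i // i ∈ A} → Fin n), monomial (monoOf A τ) 1 := by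
  unfold rowProd
  rw [← prod_coe_sort A (fun i : Fin n => ∑ j : Fin n, (X (i, j) : MvPolynomial _ ℝ≥0))]
  rw [prod_univ_sum]
  simp only [Fintype.piFinset_univ]
  refine sum_congr rfl fun τ _ => ?_
  rw [prod_X_eq_monomial_sum]
  rfl

/-- `F_A` is ordered with row set `A`. -/
theorem isOrdered_rowProd (A : Finset (Fin n)) : IsOrdered A (rowProd A) := by
  intro m hm i
  rw [rowProd_eq_sum_monomial] at hm
  obtain ⟨τ, _, hτ⟩ := mem_biUnion.1 (support_sum hm)
  have hm' : m = monoOf A τ := by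
    have := support_monomial_subset hτ
    rwa [mem_singleton] at this
  rw [hm', rowDegrees_monoOf]

/-- `F_A · F_{Aᶜ} = F_{n,n}`. -/
theorem rowProd_mul_rowProd_compl (A : Finset (Fin n)) :
    rowProd A * rowProd Aᶜ = fullSML n := by
  rw [fullSML_eq_prod_sum]
  exact prod_mul_prod_compl A _

/-! ### Coefficientwise comparisons -/

/-- `F_{n,n} ≤ F_{n,n} + M · per_n` coefficientwise. -/
theorem coeff_fullSML_le_coeff_ladder (M : ℝ≥0) (m : Fin n × Fin n →₀ ℕ) :
    coeff m (fullSML n) ≤ coeff m (ladder n M) := by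
  unfold ladder
  rw [coeff_add]
  exact le_self_add

/-- `F_{n,n} + M · per_n ≤ (1 + M) · F_{n,n}` coefficientwise. -/
theorem coeff_ladder_le_mul_coeff_fullSML (M : ℝ≥0) (m : Fin n × Fin n →₀ ℕ) :
    coeff m (ladder n M) ≤ (1 + M) * coeff m (fullSML n) := by
  by_cases h : coeff m (ladder n M) = 0
  · rw [h]; exact zero_le
  · obtain ⟨ν, rfl⟩ := exists_monoMap_of_coeff_ladder_ne_zero h
    rw [coeff_monoMap_fullSML, mul_one]
    exact coeff_monoMap_ladder_le M ν

/-! ### Valuations -/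

/-- A *valuation*: a nonnegative weight on monomials, evaluated linearly on the coefficient vector,
`val w p = ∑_{m ∈ supp p} w(m) · coeff_m p`. -/
def val (w : (Fin n × Fin n →₀ ℕ) → ℝ≥0) (p : MvPolynomial (Fin n × Fin n) ℝ≥0) : ℝ≥0 :=
  ∑ m ∈ p.support, w m * coeff m p

/-- Valuations are monotone under coefficientwise domination with a constant factor. -/
theorem val_le_mul_val {w : (Fin n × Fin n →₀ ℕ) → ℝ≥0} {p q : MvPolynomial (Fin n × Fin n) ℝ≥0}
    (c : ℝ≥0) (h : ∀ m, coeff m p ≤ c * coeff m q) : val w p ≤ c * val w q := by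
  unfold val
  have hsub : p.support ⊆ q.support := by
    intro m hm
    rw [mem_support_iff] at hm ⊢
    intro hq
    have := h m
    rw [hq, mul_zero] at this
    exact hm (le_antisymm this zero_le)
  calc ∑ m ∈ p.support, w m * coeff m p
      ≤ ∑ m ∈ p.support, w m * (c * coeff m q) :=
        sum_le_sum fun m _ => mul_le_mul_of_nonneg_left (h m) zero_le
    _ = c * ∑ m ∈ p.support, w m * coeff m q := by
        rw [mul_sum]
        exact sum_congr rfl fun m _ => by ring
    _ ≤ c * ∑ m ∈ q.support, w m * coeff m q :=
        mul_le_mul_of_nonneg_left (sum_le_sum_of_subset_of_nonneg hsub fun _ _ _ => zero_le)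
          zero_le

/-! ### The ceiling -/

/-- A balanced row set: the first `⌈n/2⌉` rows. -/
theorem exists_balanced_rows (hn : 3 ≤ n) :
    ∃ A : Finset (Fin n), n < 3 * A.card ∧ 3 * A.card ≤ 2 * n := by
  have hk : (n + 1) / 2 ≤ n := by omega
  refine ⟨univ.image (Fin.castLE hk), ?_, ?_⟩ <;>
  · rw [card_image_of_injective _ (Fin.castLE_injective hk), card_univ, Fintype.card_fin]
    omega

/-- **Valuation ceiling.**  If a valuation `w` is at most `1` on every balanced ordered product
dominated coefficientwise by `F_{n,n} + M · per_n` (the admissible terms of the structure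
decomposition of a monotone circuit computing it), then its value on `F_{n,n} + M · per_n` is at most
`1 + M`.  Hence no valuation argument proves more than `1 + M` terms, and
`soloBlind_plusLadder_sharp` (`min(2^{⌈n/3⌉}, 1+M) ≤ 8 s (n+1)²`) is optimal for this method up to the
factor `2`. -/
theorem valuation_ceiling (hn : 3 ≤ n) (M : ℝ≥0) (w : (Fin n × Fin n →₀ ℕ) → ℝ≥0)
    (hw : ∀ (A : Finset (Fin n)) (a b : MvPolynomial (Fin n × Fin n) ℝ≥0),
      IsOrdered A a → IsOrdered Aᶜ b → n < 3 * A.card → 3 * A.card ≤ 2 * n →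
      (∀ m, coeff m (a * b) ≤ coeff m (ladder n M)) → val w (a * b) ≤ 1) :
    val w (ladder n M) ≤ 1 + M := by
  obtain ⟨A, h1, h2⟩ := exists_balanced_rows hn
  have hF : val w (fullSML n) ≤ 1 := by
    rw [← rowProd_mul_rowProd_compl A]
    refine hw A (rowProd A) (rowProd Aᶜ) (isOrdered_rowProd A) (isOrdered_rowProd Aᶜ) h1 h2 ?_
    intro m
    rw [rowProd_mul_rowProd_compl A]
    exact coeff_fullSML_le_coeff_ladder M m
  calc val w (ladder n M) ≤ (1 + M) * val w (fullSML n) :=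
        val_le_mul_val (1 + M) (coeff_ladder_le_mul_coeff_fullSML M)
    _ ≤ (1 + M) * 1 := mul_le_mul_of_nonneg_left hF zero_le
    _ = 1 + M := mul_one _

/-- The ceiling restated for the polynomial of the summit's ladder,
`(∏_i ∑_j x_{i,j}) + M · ∑_σ ∏_i x_{i,σ i}`. -/
theorem soloBlind_plusLadder_valuation_ceiling (hn : 3 ≤ n) (M : ℝ≥0)
    (w : (Fin n × Fin n →₀ ℕ) → ℝ≥0)
    (hw : ∀ (A : Finset (Fin n)) (a b : MvPolynomial (Fin n × Fin n) ℝ≥0),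
      IsOrdered A a → IsOrdered Aᶜ b → n < 3 * A.card → 3 * A.card ≤ 2 * n →
      (∀ m, coeff m (a * b) ≤
        coeff m ((∏ i, ∑ j, X (i, j)) + C M * ∑ σ : Equiv.Perm (Fin n), ∏ i, X (i, σ i))) →
      val w (a * b) ≤ 1) :
    val w ((∏ i, ∑ j, X (i, j)) + C M * ∑ σ : Equiv.Perm (Fin n), ∏ i, X (i, σ i)) ≤ 1 + M := by
  have hlad : (∏ i, ∑ j, X (i, j)) + C M * ∑ σ : Equiv.Perm (Fin n), ∏ i, X (i, σ i)
      = ladder n M := by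
    unfold ladder
    rw [fullSML_eq_prod_sum, perNN_eq_sum_prod]
  rw [hlad] at hw ⊢
  exact valuation_ceiling hn M w hw

end PlusLadder

end Summit.ValiantsHypothesis.ValiantsHypothesis.Theorems

end
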